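import Mathlib
import Summits.ValiantsHypothesis.ValiantsHypothesis.Theorems.GeneratorObstructionsPowGenDegreeQPGadgetTableauCount
import Summits.ValiantsHypothesis.ValiantsHypothesis.Theorems.GeneratorObstructionsPowGenDegreeQPBlockCountEval
import Summits.ValiantsHypothesis.ValiantsHypothesis.Theorems.GeneratorObstructionsPowGenDegreeQPDoublingGadgetPow
import Summits.ValiantsHypothesis.ValiantsHypothesis.Theorems.GeneratorObstructionsPowGenDegreeQPMatIdxRevEnum

/-!
# Route GeneratorObstructions — crux K2 `PowGenDegreeQP` (stmt-ValiantsHypothesis-11655) is FALSE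

The unconditional refutation of the window form of K2,
`Summit.ValiantsHypothesis.ValiantsHypothesis.Theses.GeneratorObstructions.PowGenDegreeQP`
("the trace-power side `A(closure GL_{n²}·tr X^m)` is generated in quasi-polynomial degree
throughout the window `1 ≤ m ≤ n ≤ 2^((log₂ m + c)^c)`"), assembling the line of helper files
`…PowGenDegreeQP{EvaluationLateness, DoublingGadget*, TableauBridge, GadgetEval, MatIdxRevEnum,
BlockCountGen/Eval, DixonParity, GadgetTableau*}`:

1. (evaluation lateness + doubling gadget, `not_powGenDegreeQP_of_canonicalGadgetGIT_pow`) K2 fails as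
   soon as, for every `t ≥ 1` (`k = 2^t`, `c = 4^t`), some highest-weight vector of NONCONSTANT weight
   of `ℂ[Δ_{5k} g]` does not vanish at the canonically placed doubling gadget
   `g = Σ_{j<c} x_{B j}^k x_{A j}^{2k} x_{A' j}^{2k}` on the top `3c` matrix letters;
2. (tableau bridge, `exists_hwv_evalAtPoint_ne_zero_of_tabPoly`) the tableau polynomial of a framed
   datum on the top letters with a nonconstant column profile is such a vector once its value at `g`
   is nonzero;
3. (the explicit datum `gadgetTab k c`: frame `gadgetTabFrame`, profile `card_rowB_cols`, value
   `aeval_formCoeff_tabPoly_gadget` + `gadgetTab_count`) that value is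
   `(k!(2k)!²)^d · blockSum(k)^(2^c-1)`, and `blockSum (2^t) ≠ 0` (`blockSum_two_pow_ne_zero`:
   `blockSum k = ± C(3k,k) C(2k,k) E(k)`, `E` the Dixon sum, `E(2^t) ≡ 2 mod 8`).

Main results: `canonicalGadgetGIT_gen` (the certificate for all `k, c ≥ 1` with `blockSum k ≠ 0`),
`canonicalGadgetGIT_pow` (at `k = 2^t`, `c = 4^t`), `not_PowGenDegreeQP : ¬ PowGenDegreeQP`, and
`not_stub_sliceGen` (the registered slice stub of line `trace-side-regimes`, verbatim, is false too).

Honest framing: this REFUTES one crux (K2, window form) of one route; it says nothing about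
`VP ≠ VNP`; the route GeneratorObstructions needs re-planning at K2 (the slice restatement dies with
it). [cite: GesmundoIkenmeyerPanova2017, Prop. 5]
-/

namespace Summit.ValiantsHypothesis.ValiantsHypothesis.Theorems.GeneratorObstructions.PowGenDegreeQP

open MvPolynomial
open Literature.NumberTheory.DiophantineGeometry Literature.Computability.AlgebraicComplexity
  Literature.Computability.AlgebraicComplexity.TableauEval
open Summit.ValiantsHypothesis.ValiantsHypothesis.Theses.GeneratorObstructions

-- `Summit.ValiantsHypothesis.ValiantsHypothesis.…` is the tree's mandated single-conjunct layout.
set_option linter.dupNamespace false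

noncomputable section

/-! ## §1 The canonically placed letters are the top rows of the antitone enumeration -/

/-- The block-`j` letter of kind `κ` of the gadget tableau on the antitone enumeration of
`MatIdx (5k)` is the letter of `ι` at the canonical position `letterPos c j κ`, for any strictly
monotone `ι : Fin (3c) → MatIdx (5k)` onto a final segment. [folklore] -/
theorem matIdxRevEnum_letterRow {k c : ℕ} (ι : Fin (3 * c) → MatIdx (5 * k)) (hι : StrictMono ι)
    (hup : IsUpperSet (Set.range ι)) (dflt : MatIdx (5 * k)) {j : ℕ} (hj : j < c) (κ : Fin 3) :
    matIdxRevEnum (5 * k) dflt (letterRow c j κ) =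
      ι ⟨letterPos c j κ, lt_of_le_of_lt (letterPos_le hj κ) (by omega)⟩ := by
  have hP := letterPos_le hj κ
  have hlt : letterRow c j κ < 3 * c := by unfold letterRow; omega
  rw [matIdxRevEnum_eq_of_strictMono_isUpperSet ι hι hup dflt hlt]
  congr 1
  apply Fin.ext
  simp only
  unfold letterRow
  omega

/-- The `B` letters: `x (row B_j) = ι (B-position j)`. [folklore] -/
theorem matIdxRevEnum_rowB {k c : ℕ} (ι : Fin (3 * c) → MatIdx (5 * k)) (hι : StrictMono ι)
    (hup : IsUpperSet (Set.range ι)) (dflt : MatIdx (5 * k)) (j : Fin c) :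
    matIdxRevEnum (5 * k) dflt (letterRow c j 2) =
      ι ⟨if j.val = 0 then 0 else 3 * j.val - 1, canonPosB_lt j⟩ := by
  rw [matIdxRevEnum_letterRow ι hι hup dflt j.isLt 2]
  exact congrArg ι (Fin.ext (letterPos_two c j.val))

/-- The `A` letters: `x (row A_j) = ι (3j + 1)`. [folklore] -/
theorem matIdxRevEnum_rowA {k c : ℕ} (ι : Fin (3 * c) → MatIdx (5 * k)) (hι : StrictMono ι)
    (hup : IsUpperSet (Set.range ι)) (dflt : MatIdx (5 * k)) (j : Fin c) :
    matIdxRevEnum (5 * k) dflt (letterRow c j 1) = ι ⟨3 * j.val + 1, canonPosA_lt j⟩ := by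
  rw [matIdxRevEnum_letterRow ι hι hup dflt j.isLt 1]
  exact congrArg ι (Fin.ext (letterPos_one c j.val))

/-- The `A'` letters: `x (row A'_j) = ι (A'-position j)`. [folklore] -/
theorem matIdxRevEnum_rowA' {k c : ℕ} (ι : Fin (3 * c) → MatIdx (5 * k)) (hι : StrictMono ι)
    (hup : IsUpperSet (Set.range ι)) (dflt : MatIdx (5 * k)) (j : Fin c) :
    matIdxRevEnum (5 * k) dflt (letterRow c j 0) =
      ι ⟨if j.val = c - 1 then 3 * c - 1 else 3 * j.val + 3, canonPosA'_lt j⟩ := by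
  rw [matIdxRevEnum_letterRow ι hι hup dflt j.isLt 0]
  exact congrArg ι (Fin.ext (letterPos_zero c j.val))

/-! ## §2 The certificate -/

/-- **The explicit tableau certificate at the canonical doubling gadget.**  For `k, c ≥ 1` with
`blockSum k ≠ 0` and any strictly monotone `ι : Fin (3c) → MatIdx (5k)` onto a final segment, some
highest-weight vector of NONCONSTANT weight of `ℂ[Δ_{5k} g]` does not vanish at the canonically
placed gadget `g = Σ_{j<c} x_{B j}^k x_{A j}^{2k} x_{A' j}^{2k}` — namely the class of the tableau
polynomial of `gadgetTab k c` (bridge `exists_hwv_evalAtPoint_ne_zero_of_tabPoly`), whose value at `g`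
is `(k!(2k)!²)^d · blockSum k ^ (2^c - 1)` (`aeval_formCoeff_tabPoly_gadget`, `gadgetTab_count`).
[folklore] -/
theorem canonicalGadgetGIT_gen {k c : ℕ} (hk : 1 ≤ k) (hc : 1 ≤ c) (hbs : blockSum k ≠ 0)
    (ι : Fin (3 * c) → MatIdx (5 * k)) (hι : StrictMono ι) (hup : IsUpperSet (Set.range ι)) :
    ∃ χ₀ : Weight (MatIdx (5 * k)), (∃ a b, χ₀ a ≠ χ₀ b) ∧
      ∃ y ∈ highestWeightSpace (orbitCoordRep
          (∑ j : Fin c,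
            (X (ι ⟨if j.val = 0 then 0 else 3 * j.val - 1, canonPosB_lt j⟩) ^ k *
              (X (ι ⟨3 * j.val + 1, canonPosA_lt j⟩) ^ (2 * k) *
                X (ι ⟨if j.val = c - 1 then 3 * c - 1 else 3 * j.val + 3,
                  canonPosA'_lt j⟩) ^ (2 * k)) :
            MvPolynomial (MatIdx (5 * k)) ℂ)) (5 * k)) χ₀,
        evalAtPoint (∑ j : Fin c,
            (X (ι ⟨if j.val = 0 then 0 else 3 * j.val - 1, canonPosB_lt j⟩) ^ k *
              (X (ι ⟨3 * j.val + 1, canonPosA_lt j⟩) ^ (2 * k) *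
                X (ι ⟨if j.val = c - 1 then 3 * c - 1 else 3 * j.val + 3,
                  canonPosA'_lt j⟩) ^ (2 * k)) :
            MvPolynomial (MatIdx (5 * k)) ℂ)) (5 * k) y ≠ 0 := by
  classical
  -- the antitone enumeration of the letters and the placed letters
  have hfit : 3 * c ≤ 5 * k * (5 * k) := by
    have h := Fintype.card_le_of_injective ι hι.injective
    rwa [Fintype.card_fin, Fintype.card_lex, Fintype.card_prod, Fintype.card_fin] at h
  set x : ℕ → MatIdx (5 * k) := matIdxRevEnum (5 * k) (ι ⟨0, by omega⟩) with hxdef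
  have hx : IsAntitoneEnum x (5 * k * (5 * k)) := isAntitoneEnum_matIdxRevEnum (5 * k) _
  have hg : (∑ j : Fin c,
      (X (ι ⟨if j.val = 0 then 0 else 3 * j.val - 1, canonPosB_lt j⟩) ^ k *
        (X (ι ⟨3 * j.val + 1, canonPosA_lt j⟩) ^ (2 * k) *
          X (ι ⟨if j.val = c - 1 then 3 * c - 1 else 3 * j.val + 3, canonPosA'_lt j⟩) ^ (2 * k)) :
        MvPolynomial (MatIdx (5 * k)) ℂ)) =
      ∑ j : Fin c, (X (x (letterRow c j 2)) ^ k *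
        (X (x (letterRow c j 1)) ^ (2 * k) * X (x (letterRow c j 0)) ^ (2 * k))) := by
    refine Finset.sum_congr rfl fun j _ => ?_
    rw [hxdef, matIdxRevEnum_rowB ι hι hup _ j, matIdxRevEnum_rowA ι hι hup _ j,
      matIdxRevEnum_rowA' ι hι hup _ j]
  rw [hg]
  -- distinctness of the letters
  have hBi : Function.Injective (fun j : Fin c => x (letterRow c j 2)) := fun i j h =>
    Fin.ext (letter_inj hx hfit i.isLt j.isLt h).1
  have hBA : ∀ i j : Fin c, x (letterRow c i 2) ≠ x (letterRow c j 1) := fun i j h =>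
    absurd (letter_inj hx hfit i.isLt j.isLt h).2 (by decide)
  have hBA' : ∀ i j : Fin c, x (letterRow c i 2) ≠ x (letterRow c j 0) := fun i j h =>
    absurd (letter_inj hx hfit i.isLt j.isLt h).2 (by decide)
  have hAA' : ∀ i j : Fin c, x (letterRow c i 1) ≠ x (letterRow c j 0) := fun i j h =>
    absurd (letter_inj hx hfit i.isLt j.isLt h).2 (by decide)
  -- the bridge, applied to the gadget tableau
  refine exists_hwv_evalAtPoint_ne_zero_of_tabPoly (gadgetTab k c hk hc x) (gadgetTabFrame k c hk hc x)
    hx (fun n => (colHeight_le k c n).trans hfit) (fun _ _ => rfl)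
    (i := letterRow c 0 2) (j := 0) (by unfold letterRow; omega) (by omega) ?_ _ ?_
  · -- row `B_0` lies in `3k` columns, row `0` in all `3k·2^c`
    have h1 : (Finset.univ.filter fun n : Fin (gadgetTab k c hk hc x).C =>
        letterRow c 0 2 < (gadgetTab k c hk hc x).h n).card = 3 * k := by
      change (Finset.univ.filter fun n : Fin (3 * k * 2 ^ c) =>
        letterRow c 0 2 < colHeight k c n).card = 3 * k
      rw [card_rowB_cols hk (show 0 < c by omega), pow_zero, mul_one]
    have h2 : (Finset.univ.filter fun n : Fin (gadgetTab k c hk hc x).C =>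
        0 < (gadgetTab k c hk hc x).h n).card = 3 * k * 2 ^ c := by
      rw [Finset.filter_true_of_mem fun n _ => colHeight_pos k c n.val hk hc n.isLt,
        Finset.card_univ, Fintype.card_fin]
      rfl
    intro h
    rw [h1, h2] at h
    have h2c : 2 ≤ 2 ^ c := by
      calc (2 : ℕ) = 2 ^ 1 := by norm_num
        _ ≤ 2 ^ c := Nat.pow_le_pow_right (by norm_num) hc
    have := Nat.mul_le_mul_left (3 * k) h2c
    omega
  · -- the value of the tableau polynomial at the gadget
    rw [aeval_formCoeff_tabPoly_gadget (gadgetTab k c hk hc x) hk hBi hBA hBA' hAA',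
      gadgetTab_count k c hk hc x hx hfit]
    refine mul_ne_zero (pow_ne_zero _ ?_) (pow_ne_zero _ ?_)
    · exact_mod_cast (Nat.mul_pos (Nat.mul_pos (Nat.factorial_pos _) (Nat.factorial_pos _))
        (Nat.factorial_pos _)).ne'
    · exact_mod_cast hbs

/-- **The certificate at the parameters `k = 2^t`, `c = 4^t`** — exactly the hypothesis `hGIT` of
`not_powGenDegreeQP_of_canonicalGadgetGIT_pow`, now discharged: `blockSum (2^t) ≠ 0` by the Dixon
parity (`blockSum_two_pow_ne_zero`). [folklore] -/
theorem canonicalGadgetGIT_pow :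
    ∀ (t : ℕ) (_ : 1 ≤ t) (ι : Fin (3 * 4 ^ t) → MatIdx (5 * 2 ^ t)),
      StrictMono ι → IsUpperSet (Set.range ι) →
      ∃ χ₀ : Weight (MatIdx (5 * 2 ^ t)), (∃ i j, χ₀ i ≠ χ₀ j) ∧
        ∃ x ∈ highestWeightSpace (orbitCoordRep
          (∑ j : Fin (4 ^ t),
            (X (ι ⟨if j.val = 0 then 0 else 3 * j.val - 1, canonPosB_lt j⟩) ^ (2 ^ t) *
              (X (ι ⟨3 * j.val + 1, canonPosA_lt j⟩) ^ (2 * 2 ^ t) *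
                X (ι ⟨if j.val = 4 ^ t - 1 then 3 * 4 ^ t - 1 else 3 * j.val + 3,
                  canonPosA'_lt j⟩) ^ (2 * 2 ^ t)) :
            MvPolynomial (MatIdx (5 * 2 ^ t)) ℂ)) (5 * 2 ^ t)) χ₀,
          evalAtPoint (∑ j : Fin (4 ^ t),
            (X (ι ⟨if j.val = 0 then 0 else 3 * j.val - 1, canonPosB_lt j⟩) ^ (2 ^ t) *
              (X (ι ⟨3 * j.val + 1, canonPosA_lt j⟩) ^ (2 * 2 ^ t) *
                X (ι ⟨if j.val = 4 ^ t - 1 then 3 * 4 ^ t - 1 else 3 * j.val + 3,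
                  canonPosA'_lt j⟩) ^ (2 * 2 ^ t)) :
            MvPolynomial (MatIdx (5 * 2 ^ t)) ℂ)) (5 * 2 ^ t) x ≠ 0 :=
  fun t _ ι hι hup => canonicalGadgetGIT_gen (k := 2 ^ t) (c := 4 ^ t) Nat.one_le_two_pow
    (Nat.one_le_pow _ _ (by norm_num)) (blockSum_two_pow_ne_zero t) ι hι hup

/-! ## §3 The refutation -/

/-- **`PowGenDegreeQP` (crux K2 of route GeneratorObstructions, window form) is FALSE.**
refuted-substantive: the trace-power side `A(closure GL_{n²}·tr X^m)` is NOT generated in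
quasi-polynomial degree throughout the window `m ≤ n ≤ 2^((log₂ m + c)^c)`.  Witness: the doubling
gadget `g = Σ_{j<c} x_{B j}^k x_{A j}^{2k} x_{A' j}^{2k}` (`k = 2^t`, `c = 4^t`, `t = 2(c₀+2)²`) lies in
the orbit closure of `tr X^{5k}` inside the window `c = 2`, and the explicit tableau highest-weight
vector of `gadgetTab k c` has nonconstant weight and value `(k!(2k)!²)^d · blockSum(k)^{2^c-1} ≠ 0`
at `g` (`blockSum (2^t) = ± C(3k,k) C(2k,k) · E(k)`, `E` the Dixon sum, `E(2^t) ≡ 2 mod 8`), which by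
evaluation lateness (`not_powGenDegreeQP_of_canonicalGadgetGIT_pow`) forces a generator type of
degree `> 5k · 2^((log₂ 5k + c₀)^c₀)` for every `c₀`.  No cheap repair: the same certificate refutes
the slice half `stub_sliceGen` (below), i.e. the restriction to generator types supported on a final
segment of own letters; the phenomenon is exponential generation degree of GL-orbit closures of
padded power-type forms inside the quasi-polynomial window, not a missing side condition.
[cite: GesmundoIkenmeyerPanova2017, Prop. 5] -/
theorem not_PowGenDegreeQP : ¬ PowGenDegreeQP :=
  not_powGenDegreeQP_of_canonicalGadgetGIT_pow canonicalGadgetGIT_pow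

/-- **The registered stub `stub_sliceGen` of line `trace-side-regimes` is FALSE** (statement
verbatim, negated): the same certificate via `not_sliceGen_of_canonicalGadgetGIT_pow`.
[cite: GesmundoIkenmeyerPanova2017, Prop. 5] -/
theorem not_stub_sliceGen :
    ¬ (∀ c : ℕ, ∃ c₀ : ℕ, ∀ m e : ℕ, 1 ≤ m → m + e ≤ 2 ^ ((Nat.log 2 m + c) ^ c) →
      ∀ ι : MatIdx m → MatIdx (m + e), StrictMono ι → IsUpperSet (Set.range ι) →
        ∀ χ : Weight (MatIdx m),
          Module.finrank ℂ (↥(highestWeightSpace (orbitCoordRep (powFormLex ℂ (m + e) m) m) (Function.extend ι χ 0)) ⧸ Submodule.comap (highestWeightSpace (orbitCoordRep (powFormLex ℂ (m + e) m) m) (Function.extend ι χ 0)).subtype (⨆ p : Weight (MatIdx (m + e)) × Weight (MatIdx (m + e)), ⨆ (_ : p.1 + p.2 = (Function.extend ι χ 0) ∧ p.1 ≠ 0 ∧ p.2 ≠ 0), highestWeightSpace (orbitCoordRep (powFormLex ℂ (m + e) m) m) p.1 * highestWeightSpace (orbitCoordRep (powFormLex ℂ (m + e) m) m) p.2)) ≠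 0 →
            -(Weight.size χ) ≤ (m : ℤ) * 2 ^ ((Nat.log 2 m + c₀) ^ c₀)) :=
  not_sliceGen_of_canonicalGadgetGIT_pow canonicalGadgetGIT_pow

end

end Summit.ValiantsHypothesis.ValiantsHypothesis.Theorems.GeneratorObstructions.PowGenDegreeQP
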